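import Mathlib
import HarnessLib

/-!
# Harvey 2021: Strassen's small-factor test and the reduction to semiprimes (the mathematics)

Continuing `Harvey2021.lean` / `Harvey2021Search.lean` (the algebra of §3–§4 of D. Harvey,
*An exponent one-fifth algorithm for deterministic integer factorisation*, Math. Comp. 90
(2021)), this file proves the elementary number theory behind two further steps of the
algorithm, leaving the machines (product tree, multipoint evaluation, the loop) to the
stack-program layer:

* **Prop. 2.5** (journal) = Prop. 6 (arXiv), Strassen's method: with `d = ⌈M^{1/2}⌉` and the
  blocks `f(jd) = (jd+1)⋯(jd+d)`, `j < d`: blocks lying below the least prime factor are coprime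
  to `N` (`coprime_blockProd_of_lt_minFac`); the block `j = (p−1)/d` containing
  `p = minFac N ≤ d²` is not (`not_coprime_blockProd_minFac`), and inside it the first
  constituent not coprime to `N` is `p` itself (`coprime_of_lt_minFac`,
  `minFac_eq_block_add`) — so scanning the `d` block products and then one block finds the
  smallest prime divisor `≤ d²`, or certifies that there is none (`exists_prime_le_iff_block`);
* **proof of Thm. 1.1** (journal) = Thm. 1 (arXiv), reduction to semiprimes: once every prime
  factor of `N` exceeds `M` with `N ≤ M³` (all factors `≤ ⌈N^{1/3}⌉` stripped), `N` has at
  most two prime factors with multiplicity (`length_primeFactorsList_le_two`), and if it has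
  two and is not a square they are distinct (`ne_of_not_isSquare`).

## References

* D. Harvey, Math. Comp. 90 (2021) 2937–2950: Prop. 2.5 and the proof of Thm. 1.1
  (arXiv:2010.05450: Prop. 6, p. 6; proof of Thm. 1, p. 10; text checked,
  `paper:arxiv-2010.05450`). [Harvey2021]
* V. Strassen, *Einige Resultate über Berechnungskomplexität*, Jber. Deutsch. Math.-Verein. 78
  (1976) 1–8 (the method); A. Bostan, P. Gaudry, É. Schost, SIAM J. Comput. 36 (2007)
  (the arithmetic-progression form used here).
-/

namespace Literature.Computability.Cryptography

namespace Harvey2021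

open Finset

/-! ### Strassen's method (Prop. 2.5 = arXiv Prop. 6) -/

/-- The `j`-th block product of Strassen's method: `f(jd) = (jd+1)(jd+2)⋯(jd+d)` where
`f(x) = (x+1)⋯(x+d)`. [cite: Harvey2021, Prop. 2.5 (arXiv Prop. 6), proof] -/
def blockProd (d j : ℕ) : ℕ := ∏ i ∈ Icc 1 d, (j * d + i)

/-- Numbers below the least prime factor of `N` are coprime to `N`. [folklore] -/
theorem coprime_of_lt_minFac {N m : ℕ} (hm0 : 0 < m) (hm : m < N.minFac) : Nat.Coprime m N := by
  by_contra h
  have hg1 : 1 < Nat.gcd m N := by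
    rcases Nat.lt_or_ge 1 (Nat.gcd m N) with h1 | h1
    · exact h1
    · exfalso
      have hpos : 0 < Nat.gcd m N := Nat.gcd_pos_of_pos_left N hm0
      exact h (le_antisymm h1 hpos)
  have hq : (Nat.gcd m N).minFac ∣ N := (Nat.minFac_dvd _).trans (Nat.gcd_dvd_right m N)
  have hqprime : (Nat.gcd m N).minFac.Prime := Nat.minFac_prime hg1.ne'
  have h1 : N.minFac ≤ (Nat.gcd m N).minFac := Nat.minFac_le_of_dvd hqprime.two_le hq
  have h2 : (Nat.gcd m N).minFac ≤ Nat.gcd m N := Nat.minFac_le (by omega)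
  have h3 : Nat.gcd m N ≤ m := Nat.le_of_dvd hm0 (Nat.gcd_dvd_left m N)
  omega

/-- **Blocks below the least prime factor pass the test**: if `(j+1)d < minFac N` then
`f(jd) = (jd+1)⋯(jd+d)` is coprime to `N`. [cite: Harvey2021, Prop. 2.5 (arXiv Prop. 6), proof] -/
theorem coprime_blockProd_of_lt_minFac {N d j : ℕ} (h : (j + 1) * d < N.minFac) :
    Nat.Coprime (blockProd d j) N := by
  unfold blockProd
  refine Nat.coprime_prod_left_iff.2 fun i hi => ?_
  obtain ⟨hi1, hid⟩ := mem_Icc.1 hi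
  exact coprime_of_lt_minFac (by omega) (by nlinarith)

/-- **The block containing the least prime factor fails the test**: if `1 < N` and
`p = minFac N ≤ d·d` then, with `j = (p−1)/d`, we have `j < d`, `jd < p ≤ jd + d`, and
`f(jd)` is not coprime to `N` (it is divisible by `p`). [cite: Harvey2021, Prop. 2.5 (arXiv Prop. 6), proof] -/
theorem not_coprime_blockProd_minFac {N d : ℕ} (hN : 1 < N) (hd : 0 < d)
    (hp : N.minFac ≤ d * d) :
    (N.minFac - 1) / d < d ∧ (N.minFac - 1) / d * d < N.minFac ∧
      N.minFac ≤ (N.minFac - 1) / d * d + d ∧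
      ¬ Nat.Coprime (blockProd d ((N.minFac - 1) / d)) N := by
  set p := N.minFac with hp'
  have hp2 : 2 ≤ p := (Nat.minFac_prime hN.ne').two_le
  set j := (p - 1) / d with hj
  have hj1 : j * d ≤ p - 1 := Nat.div_mul_le_self (p - 1) d
  have hj2 : p - 1 < j * d + d := by
    have := Nat.lt_div_mul_add (a := p - 1) hd
    simpa [hj, Nat.succ_mul, mul_comm] using this
  have hjd : j < d := by
    by_contra hc
    push Not at hc
    have : d * d ≤ j * d := Nat.mul_le_mul_right d hc
    omega
  refine ⟨hjd, by omega, by omega, fun hcop => ?_⟩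
  -- `p = jd + i` with `1 ≤ i ≤ d` is a constituent of the block
  have hmem : p - j * d ∈ Icc 1 d := mem_Icc.2 ⟨by omega, by omega⟩
  have hdvd : p ∣ blockProd d j := by
    unfold blockProd
    have : j * d + (p - j * d) = p := by omega
    exact this ▸ dvd_prod_of_mem (fun i => j * d + i) hmem
  have hpN : p ∣ N := Nat.minFac_dvd N
  have h1 : p ∣ Nat.gcd (blockProd d j) N := Nat.dvd_gcd hdvd hpN
  rw [hcop] at h1
  exact absurd (Nat.le_of_dvd one_pos h1) (by omega)

/-- **Locating the factor inside the failing block**: the constituents `jd + i` with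
`jd + i < minFac N` are coprime to `N`, and `jd + (minFac N − jd) = minFac N` divides `N`; so
the first `i ∈ [1, d]` with `gcd(jd+i, N) > 1` is `i = minFac N − jd`. [cite: Harvey2021, Prop. 2.5 (arXiv Prop. 6), proof] -/
theorem minFac_eq_block_add {N d : ℕ} (hN : 1 < N) (hd : 0 < d) (hp : N.minFac ≤ d * d) :
    let j := (N.minFac - 1) / d
    (∀ i, 1 ≤ i → j * d + i < N.minFac → Nat.Coprime (j * d + i) N) ∧
      1 ≤ N.minFac - j * d ∧ N.minFac - j * d ≤ d ∧
      j * d + (N.minFac - j * d) = N.minFac ∧ ¬ Nat.Coprime N.minFac N := by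
  obtain ⟨-, hlt, hle, -⟩ := not_coprime_blockProd_minFac hN hd hp
  refine ⟨fun i hi hlt' => coprime_of_lt_minFac (by omega) hlt', by omega, by omega, by omega,
    fun hcop => ?_⟩
  have hp2 : 2 ≤ N.minFac := (Nat.minFac_prime hN.ne').two_le
  have : Nat.gcd N.minFac N = N.minFac := Nat.gcd_eq_left (Nat.minFac_dvd N)
  rw [hcop] at this
  omega

/-- **Prop. 2.5 as a test** (arXiv Prop. 6: "test if `N` has a prime divisor `p ≤ M`"): for
`1 < N` and `d ≥ 1`, `N` has a prime divisor `≤ d·d` iff one of the `d` block products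
`f(0), f(d), …, f((d−1)d)` is not coprime to `N`. [cite: Harvey2021, Prop. 2.5 (arXiv Prop. 6)] -/
theorem exists_prime_le_iff_block {N d : ℕ} (hN : 1 < N) (hd : 0 < d) :
    (∃ p, p.Prime ∧ p ∣ N ∧ p ≤ d * d) ↔ ∃ j < d, ¬ Nat.Coprime (blockProd d j) N := by
  constructor
  · rintro ⟨p, hp, hpN, hpd⟩
    have hmin : N.minFac ≤ d * d := (Nat.minFac_le_of_dvd hp.two_le hpN).trans hpd
    obtain ⟨hjd, -, -, hnc⟩ := not_coprime_blockProd_minFac hN hd hmin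
    exact ⟨_, hjd, hnc⟩
  · rintro ⟨j, hjd, hnc⟩
    refine ⟨N.minFac, Nat.minFac_prime hN.ne', Nat.minFac_dvd N, ?_⟩
    by_contra hlt
    push Not at hlt
    refine hnc (coprime_blockProd_of_lt_minFac (lt_of_le_of_lt ?_ hlt))
    nlinarith

/-! ### Reduction to semiprimes (proof of Thm. 1.1 = arXiv Thm. 1) -/

/-- **At most two prime factors remain**: if every prime factor of `N ≠ 0` exceeds `M` and
`N ≤ M³` (e.g. `M = ⌈N^{1/3}⌉` after stripping all prime factors `≤ M`), then `N` has at most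
two prime factors counted with multiplicity. [cite: Harvey2021, Thm 1.1 (arXiv Thm 1), proof] -/
theorem length_primeFactorsList_le_two {N M : ℕ} (hN : N ≠ 0) (hM : N ≤ M ^ 3)
    (hbig : ∀ p ∈ N.primeFactorsList, M < p) : N.primeFactorsList.length ≤ 2 := by
  by_contra h
  push Not at h
  -- three prime factors `a, b, c` with multiplicity
  obtain ⟨a, b, c, rest, hl⟩ : ∃ a b c rest, N.primeFactorsList = a :: b :: c :: rest := by
    match hN' : N.primeFactorsList, h with
    | a :: b :: c :: rest, _ => exact ⟨a, b, c, rest, rfl⟩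
    | [], h => simp at h
    | [_], h => simp at h
    | [_, _], h => simp at h
  have hprod : (a :: b :: c :: rest).prod = N := hl ▸ Nat.prod_primeFactorsList hN
  have ha : M < a := hbig a (by simp [hl])
  have hb : M < b := hbig b (by simp [hl])
  have hc : M < c := hbig c (by simp [hl])
  have hrest : 0 < rest.prod := by
    refine Nat.pos_of_ne_zero (List.prod_ne_zero fun h0 => ?_)
    have : (0 : ℕ) ∈ N.primeFactorsList := by simp [hl, h0]
    exact Nat.not_prime_zero (Nat.prime_of_mem_primeFactorsList this)
  simp only [List.prod_cons] at hprod
  have h1 : M ^ 3 < a * (b * c) := by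
    calc M ^ 3 = M * (M * M) := by ring
      _ < a * (b * c) := by
        exact Nat.mul_lt_mul_of_lt_of_le ha (Nat.mul_le_mul hb.le hc.le)
          (Nat.mul_pos (by omega) (by omega))
  have h2 : a * (b * c) ≤ N := by
    rw [← hprod]
    exact Nat.le_mul_of_pos_right _ hrest |>.trans_eq (by ring)
  omega

/-- **The square test separates `p²` from `pq`**: if `N = p·q` with `p, q` its two prime
factors and `N` is not a perfect square, then `p ≠ q`. [cite: Harvey2021, Thm 1.1 (arXiv Thm 1), proof] -/
theorem ne_of_not_isSquare {N p q : ℕ} (h : N.primeFactorsList = [p, q]) (hsq : ¬ IsSquare N)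
    (hN : N ≠ 0) : p ≠ q := by
  rintro rfl
  apply hsq
  refine ⟨p, ?_⟩
  have := Nat.prod_primeFactorsList hN
  rw [h] at this
  simpa using this.symm

end Harvey2021

end Literature.Computability.Cryptography
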